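import Mathlib
import HarnessLib
import Summits.NavierStokesRegularity.NavierStokesRegularity.Theses.PoloidalWindowDoor
import Summits.NavierStokesRegularity.NavierStokesRegularity.Theorems.LiouvilleConjectureNS
import Summits.NavierStokesRegularity.NavierStokesRegularity.Theorems.PoloidalWindowDoorPoloidalWindowRigidityWindow
import Summits.NavierStokesRegularity.NavierStokesRegularity.Theorems.PoloidalWindowDoorLocalPointZoomSlices

/-!
# Route `PoloidalWindowDoor`: the crux `PoloidalWindowRigidity` (stmt-NavierStokesRegularity-19708) and the promoted stub
# `LrcModEntire` (stmt-NavierStokesRegularity-20428) sit BELOW the KNSS Liouville conjecture (L) — CONDITIONAL bridges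
# (ladder placement); nothing is closed by this file

Seat ns-poloidal-K2-p2 g10 (LEAD-lineage on 19708; file `--supports`).  The crux quantifies over the route's Type-I
ancient mild class (rate `‖v(t,x)‖ ≤ C/√(−t)`, continuity on the open backward slab, unit-viscosity Oseen identity
between negative times, divergence-free slices).  That class is the tree's Type-I KNSS-mild class
(`…PoloidalWindowRigidityWindow.isTypeIAncientMild_of_class`), and under the Liouville conjecture (L) of
Koch–Nadirashvili–Seregin–Šverák — canonical obligation `Summit.NavierStokesRegularity.NavierStokesRegularity.LiouvilleConjectureNS`,
item stmt-NavierStokesRegularity-10661 — every Type-I KNSS-mild field VANISHES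
(the argument of `…SqueezeCycleExtremalBiaxialitySubcriticalOfLiouville.typeIAncientMild_eq_zero_of_liouvilleConjectureNS`,
re-run here on the class binders to keep this file inside the route's import cone: the time shift `t ↦ v(t − δ)` is a
bounded ancient mild solution `IsTypeIAncientMild.isBoundedAncientMildSolution_sub`, (L) makes its slices a.e. — hence
everywhere — constant, and `IsTypeIAncientMild.eq_zero_of_slice_const` (Oseen gauge + rate) sends the constant to `0`).
A zero field has continuous (zero) vorticity slices and vanishes on the unit past ball `Q_1(0,0)`, so it is not
backward-singular at the apex; BOTH clauses of the crux hold — the poloidal window hypothesis is not used: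

* `class_eq_zero_of_liouvilleConjectureNS` — (L) ⇒ every profile of the route's class is `≡ 0` on `t < 0`;
* `poloidalWindowRigidity_of_liouvilleConjectureNS : LiouvilleConjectureNS → PoloidalWindowRigidity`;
* `lrcModEntire_of_liouvilleConjectureNS : LiouvilleConjectureNS → LrcModEntire` (20428: its non-degeneracy hypothesis
  `curl v ≠ 0` on a nonempty open space–time set is incompatible with `v ≡ 0`, so the statement holds vacuously);
* `target_of_liouvilleConjectureNS : LiouvilleConjectureNS → Target` — the rung leaf N0-LocalTubeDoorPoloidal below (L), via
  the route's deciding theorem `closes` and the tree theorem K1 `localPointZoomSlices_proof` (appended).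

These are `conditional-result`s (hypothesis = an open conjecture); they record the dependencies 19708 ⇐ (L) = 10661 and 20428 ⇐ (L)
kernel-checked, as `…HalfSpaceWindowDoorCirculationCarryingRigidityOfLiouville` does for crux 25311 and
`…SqueezeCycleExtremalBiaxialitySubcriticalOfLiouville` for 11609.  The unconditional reductions of record remain
`…PoloidalWindowRigidityFarThreadReductionNUGRS.poloidalWindowRigidity_of_NUGRS_of_threadedThick` (19708 ⇐ 20428's stubs S0, S3).

WHAT THIS IS NOT: not a proof of the crux, not a statement about Navier–Stokes regularity (Clay A OPEN; (L) OPEN).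
[cite: KochNadirashviliSereginSverak2009, §1 conjecture (L)]
-/

noncomputable section

-- the summit and its single sub-problem share the name (CONVENTIONS §1), as in every Theorems file
set_option linter.dupNamespace false

namespace Summit.NavierStokesRegularity.NavierStokesRegularity.Theorems.PoloidalWindowDoorOfLiouville

open MeasureTheory Set Function Filter Topology
open scoped RealInnerProductSpace InnerProductSpace
open Literature.Analysis Literature.Analysis.FluidPDE
open Summit.NavierStokesRegularity.NavierStokesRegularity (LiouvilleConjectureNS)
open Summit.NavierStokesRegularity.NavierStokesRegularity.Theses.PoloidalWindowDoor (PoloidalWindowRigidity LrcModEntire)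
open Summit.NavierStokesRegularity.NavierStokesRegularity.Theorems.PoloidalWindowDoorPoloidalWindowRigidityWindow
  (isTypeIAncientMild_of_class)

variable {C : ℝ} {v : ℝ → EuclideanSpace ℝ (Fin 3) → EuclideanSpace ℝ (Fin 3)}

/-- **(L) empties the route's Type-I class**: under the KNSS Liouville conjecture every Type-I ancient Oseen-mild
profile (rate, continuity, Oseen identity, divergence-free slices) vanishes identically on `t < 0`.  The class is the
tree's Type-I KNSS-mild class (`isTypeIAncientMild_of_class`); for `δ > 0` the shift `s ↦ v(s − δ)` is a bounded ancient
mild solution with continuous (measurable) slices, (L) makes each slice a.e. and hence everywhere constant, and a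
slice-constant Type-I KNSS-mild field is zero (`IsTypeIAncientMild.eq_zero_of_slice_const`); take `δ = −t/2`.
CONDITIONAL on the open conjecture `LiouvilleConjectureNS`. [cite: KochNadirashviliSereginSverak2009, §1 conjecture (L) and Remark 6.1] -/
theorem class_eq_zero_of_liouvilleConjectureNS (hL : LiouvilleConjectureNS) (hrate : HasTypeITimeDecay C v)
    (hcont : ContinuousOn (uncurry v) (Iio (0 : ℝ) ×ˢ univ))
    (hmild : ∀ s t : ℝ, s < t → t < 0 → ∀ x,
      v t x = UnboundedOperators.heatExtension (v s) (t - s) x - oseenDuhamel 1 s v v t x)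
    (hdiv : ∀ t < 0, VectorCalculus.IsDivFree (v t)) : ∀ t < 0, ∀ x, v t x = 0 := by
  intro t ht x
  have h : IsTypeIAncientMild C v := isTypeIAncientMild_of_class hrate hcont hmild hdiv
  set δ : ℝ := -t / 2 with hδ
  have hδ0 : 0 < δ := by rw [hδ]; linarith
  -- the shifted field is a bounded ancient mild solution with continuous slices
  set w : ℝ → EuclideanSpace ℝ (Fin 3) → EuclideanSpace ℝ (Fin 3) := fun s => v (s - δ) with hw
  have hwT : IsTypeIAncientMild C w := h.comp_sub_right hδ0.le
  have hwB : IsBoundedAncientMildSolution 1 w := h.isBoundedAncientMildSolution_sub hδ0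
  have hwm : ∀ s < 0, AEStronglyMeasurable (w s) volume := fun s hs => hwT.aestronglyMeasurable_slice hs
  -- (L): every slice of `w` is a.e. constant, hence constant
  have hconst : ∀ s < 0, ∃ b : EuclideanSpace ℝ (Fin 3), ∀ y, w s y = b := by
    intro s hs
    obtain ⟨b, hb⟩ := hL w hwB hwm s hs
    refine ⟨b, fun y => ?_⟩
    have hc : w s = fun _ => b := ((hwT.continuous_slice hs).ae_eq_iff_eq volume continuous_const).1 hb
    exact congrFun hc y
  choose! b hb using hconst
  have hzero : ∀ s < 0, ∀ y, w s y = 0 := fun s hs y =>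
    hwT.eq_zero_of_slice_const (fun s' hs' y' => hb s' hs' y') hs y
  have key := hzero (t + δ) (by rw [hδ]; linarith) x
  simpa only [hw, add_sub_cancel_right] using key

/-- **Crux 19708 `PoloidalWindowRigidity` from the Liouville conjecture (L)** (conditional bridge).  Under (L) a profile of
the class is `≡ 0` (`class_eq_zero_of_liouvilleConjectureNS`); its vorticity slices are the zero field (continuous), and it
vanishes on the unit past ball `Q_1(0,0)`, whose `L^∞` norm is then `0 ≠ ∞` — not backward-singular at the apex.  The
poloidal window hypothesis of clause (b) is not needed. [cite: KochNadirashviliSereginSverak2009, §1 conjecture (L)] -/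
theorem poloidalWindowRigidity_of_liouvilleConjectureNS (hL : LiouvilleConjectureNS) : PoloidalWindowRigidity := by
  intro C v hrate hcont hmild hdiv
  have hz : ∀ t < 0, ∀ x, v t x = 0 := class_eq_zero_of_liouvilleConjectureNS hL hrate hcont hmild hdiv
  refine ⟨fun s hs => ?_, fun _e _he _hwin hsing => ?_⟩
  · have hvs : v s = fun _ => 0 := funext (hz s hs)
    have hcurl : curl (v s) = fun _ => 0 := by
      funext y
      rw [hvs]
      ext i
      fin_cases i <;> simp [curl]
    rw [hcurl]
    exact continuous_const
  · have h1 := hsing 1 one_pos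
    have hae : uncurry v =ᵐ[volume.restrict (parabolicCylinder 1 (0 : ℝ × EuclideanSpace ℝ (Fin 3)))] 0 := by
      filter_upwards [ae_restrict_mem (isOpen_parabolicCylinder 1 (0 : ℝ × EuclideanSpace ℝ (Fin 3))).measurableSet]
        with z hz'
      rw [mem_parabolicCylinder] at hz'
      have ht : z.1 < 0 := by simpa using hz'.1.2
      simp [uncurry, hz z.1 ht z.2]
    rw [eLpNorm_congr_ae hae, eLpNorm_zero] at h1
    exact ENNReal.zero_ne_top h1

/-- **Item 20428 `LrcModEntire` from the Liouville conjecture (L)** (conditional bridge, vacuous case).  Under (L) a profile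
of the class is `≡ 0` (`class_eq_zero_of_liouvilleConjectureNS`), so no nonempty open space–time set `W` of the backward
slab carries the non-degeneracy pin `curl v ≠ 0`; the conclusion is never invoked. [cite: KochNadirashviliSereginSverak2009, §1 conjecture (L)] -/
theorem lrcModEntire_of_liouvilleConjectureNS (hL : LiouvilleConjectureNS) : LrcModEntire := by
  intro C v hrate hcont hmild hdiv _hpol W _hW hWne hWsub hpins _hslope
  obtain ⟨z, hz⟩ := hWne
  have hz1 : z.1 < 0 := (Set.mem_prod.1 (hWsub hz)).1
  have hvs : v z.1 = fun _ => 0 := funext (class_eq_zero_of_liouvilleConjectureNS hL hrate hcont hmild hdiv z.1 hz1)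
  have hcurl : curl (v z.1) z.2 = 0 := by
    rw [hvs]
    ext i
    fin_cases i <;> simp [curl]
  exact absurd hcurl (hpins z hz).1

/-- **The rung leaf `Target` (N0-LocalTubeDoorPoloidal) from the Liouville conjecture (L)** (conditional; appended
2026-08-28): the route's deciding theorem `Theses.PoloidalWindowDoor.closes` applied to the tree theorem K1
(`…PoloidalWindowDoorLocalPointZoomSlices.localPointZoomSlices_proof`) and to K2 under (L)
(`poloidalWindowRigidity_of_liouvilleConjectureNS`). [cite: KochNadirashviliSereginSverak2009, §1 conjecture (L)] -/
theorem target_of_liouvilleConjectureNS (hL : LiouvilleConjectureNS) :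
    Summit.NavierStokesRegularity.NavierStokesRegularity.Theses.PoloidalWindowDoor.Target :=
  Summit.NavierStokesRegularity.NavierStokesRegularity.Theses.PoloidalWindowDoor.closes
    Summit.NavierStokesRegularity.NavierStokesRegularity.Theorems.PoloidalWindowDoorLocalPointZoomSlices.localPointZoomSlices_proof
    (poloidalWindowRigidity_of_liouvilleConjectureNS hL)

end Summit.NavierStokesRegularity.NavierStokesRegularity.Theorems.PoloidalWindowDoorOfLiouville

end
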